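import Summits.ABC.StewartYu.PadicG3TwoMain
import Summits.ABC.StewartYu.PadicG3TwoSlabSiegel
import Summits.ABC.StewartYu.PadicG3TwoFeldmanAdm
import HarnessLib

/-!
# Cell abc-stewartyu, Gen-3 frame at `p = 2` (crux `Y07Two`, stmt-ABC-19659): LEVEL 0 DISCHARGED — p5-g3's
# `SiegelTwo σ Sh` for the Fel'dman family on the box, from the slab Siegel lemma and the record's scalar lines

`Summits/ABC/StewartYu/PadicG3TwoLevelZero.lean` — cell `abc-stewartyu` (HOME `run/shared/lean/pub/abc-stewartyu/`),
route `PadicPrimesKummerThird`, seat p3 (g5), F-two LEAD.  One theorem composing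
`PadicG3TwoSlabSiegel.exists_g3_slab_siegel` (p3), `PadicG3TwoBoxes` (box `famBox`, equations `eqSet`, count),
`PadicG3TwoFeldmanAdm` (the admissibility fields of the Fel'dman basis) into the level-0 `Prop` of p5-g3's level
induction `PadicG3TwoMain.SiegelTwo σ Sh` — for the family `i = (ℓ₀, (u, u_θ)) ↦ (Δ(Y₀; ℓ₀, H), u, u_θ)` on ONE slab
class `𝔏 ⊆ famBox L₀ (Dbox 0) (Dθ 0)`, given: the negated-bound smallness `‖Λ₀‖ ≤ 2^{−(m+3)}`
(`PadicG3TwoNegBound`), the record's scalar lines (Siegel count `2·2^m·(2N₀+1)·T₀^{d+1} ≤ #famBox`, `#famBox ≤ cardB 0`,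
`L₀ ≤ D₀`, directional bound `Xb 0`, weight line `Bw 0`, `den₀ 0 x τ = ν(H)^{τ.1}`, pointwise `M₀ 0`, the Siegel
height `Amax` with `⌈#famBox·Amax⌉ ≤ P`), and the assembler's shape predicate at level `0` for every sub-box
Fel'dman family.

WHAT THIS IS NOT: the k-chains, the third steps, the record; no crux moves.

References: K. Yu, Acta Math. 211 (2013), Lemma 4.2, (5.22); Yu. V. Nesterenko, LNM 1819 (2003), §3.4–3.5.
-/

noncomputable section

open Finset Polynomial
open Literature.NumberTheory.Transcendental
open Literature.NumberTheory.Transcendental (FeldmanDelta.den)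
open Literature.NumberTheory.Transcendental.FeldmanDelta
open Literature.NumberTheory.Transcendental.CW77.Setup (Tau tauNorm)

namespace Summit.ABC.StewartYu.TwoSetup

open Summit.ABC.StewartYu.FeldmanBasis Summit.ABC.StewartYu.G3Boxes

variable {S : TwoSetup} (σ : S.G3TwoSched) (Sh : ℕ → S.G3Fam (ℕ × ((Fin S.d → ℤ) × ℤ)) → Prop)

/-- **LEVEL 0 OF THE Gen-3 `2`-ADIC FRAME** (`SiegelTwo σ Sh` for the Fel'dman family on one slab class of the box).
See the module docstring for the list of scalar hypotheses (the record's lines). [cite: Yu2013, Lemma 4.2, (5.22)] -/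
theorem siegelTwo_feldman (H L₀ : ℕ) (hH : 1 ≤ H)
    (hΛ : ‖S.Λ₀‖ ≤ ((2 : ℝ) ^ (σ.m + 3))⁻¹)
    (hT0 : 1 ≤ σ.T0 0)
    (hcount : 2 * 2 ^ σ.m * ((2 * σ.N0 0 + 1) * σ.T0 0 ^ (S.d + 1)) ≤
      (L₀ + 1) * ((∏ j, (2 * σ.Dbox 0 j + 1)) * (2 * σ.Dθ 0 + 1)))
    (hcardB : (famBox L₀ (σ.Dbox 0) (σ.Dθ 0)).card ≤ σ.cardB 0)
    (hL : L₀ ≤ σ.D₀)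
    (hXb : ∀ i ∈ famBox L₀ (σ.Dbox 0) (σ.Dθ 0), ∀ j, |S.dirScalar i.2.1 i.2.2 j| ≤ σ.Xb 0)
    (hBw : ∀ ℓ, ℓ ≤ L₀ → ‖((den ℓ H : ℚ_[2]))⁻¹‖ * (4 * (2 : ℝ) ^ σ.m) ^ ℓ ≤ σ.Bw 0)
    (hden₀ : ∀ (x : ℤ) (τ : Tau S.d), σ.den₀ 0 x τ = Nat.lcmUpto H ^ τ.1)
    (hM₀ : ∀ (x : ℤ) (τ : Tau S.d), ∀ ℓ, ℓ ≤ L₀ → (Nat.lcmUpto H : ℝ) ^ τ.1 *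
      (Real.exp (H / Real.exp 1) * (Real.exp 1 * (1 + |(x : ℝ)| / H)) ^ ℓ) ≤ σ.M₀ 0 x τ)
    {M₀E : ℤ} (hM₀E : ∀ e ∈ eqSet S.d (σ.N0 0) (σ.T0 0), σ.M₀ 0 e.1 e.2 ≤ M₀E)
    {Amax : ℝ} (hAmax : 1 ≤ Amax)
    (hA : ∀ e ∈ eqSet S.d (σ.N0 0) (σ.T0 0), (M₀E : ℝ) * (σ.Xb 0 : ℝ) ^ (∑ j, e.2.2 j) *
      ((MonomialDen.monDen S.toQ.all (S.boxExp (σ.Dbox 0) (σ.Dθ 0) e.1) : ℝ)) ^ 2 ≤ Amax)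
    (hP : ⌈((famBox L₀ (σ.Dbox 0) (σ.Dθ 0)).card : ℝ) * Amax⌉ ≤ σ.P)
    (hSh : ∀ (B' : Finset (ℕ × ((Fin S.d → ℤ) × ℤ))) (p : ℕ × ((Fin S.d → ℤ) × ℤ) → ℤ)
      (i₀ : ℕ × ((Fin S.d → ℤ) × ℤ)), B' ⊆ famBox L₀ (σ.Dbox 0) (σ.Dθ 0) → i₀ ∈ B' →
      Sh 0 ⟨B', fun i => feldR i.1 H, fun i => i.2.1, fun i => i.2.2, p, i₀⟩) :
    SiegelTwo σ Sh := by
  classical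
  set B : Finset (ℕ × ((Fin S.d → ℤ) × ℤ)) := famBox L₀ (σ.Dbox 0) (σ.Dθ 0) with hBdef
  set E : Finset (ℤ × Tau S.d) := eqSet S.d (σ.N0 0) (σ.T0 0) with hEdef
  set R : ℕ × ((Fin S.d → ℤ) × ℤ) → ℚ[X] := fun i => feldR i.1 H with hRdef
  set u : ℕ × ((Fin S.d → ℤ) × ℤ) → Fin S.d → ℤ := fun i => i.2.1 with hudef
  set uθ : ℕ × ((Fin S.d → ℤ) × ℤ) → ℤ := fun i => i.2.2 with huθdef
  have hbox := S.feldman_box_le B (subset_refl _)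
  -- the pointwise `Y₀`-weight data on `E`, uniformised by `M₀E`
  have hlcm1 : 1 ≤ Nat.lcmUpto H := Nat.lcmUpto_pos H
  have hden₀1 : ∀ e ∈ E, 1 ≤ σ.den₀ 0 e.1 e.2 := by
    intro e _; rw [hden₀]; exact Nat.one_le_pow _ _ hlcm1
  have hR : ∀ e ∈ E, ∀ i ∈ B, ∃ z₀ : ℤ,
      ((σ.den₀ 0 e.1 e.2 : ℕ) : ℚ) * (hasseDeriv e.2.1 (R i)).eval (e.1 : ℚ) = z₀ ∧ |z₀| ≤ M₀E := by
    intro e he i hi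
    obtain ⟨z₀, hz₀, hle⟩ := S.feldman_hasse H hH B (subset_refl _) (σ.M₀ 0) hM₀ i hi e.1 e.2
    refine ⟨z₀, ?_, hle.trans (hM₀E e he)⟩
    rw [hden₀]; exact hz₀
  -- the slab Siegel lemma
  obtain ⟨𝔏, p, h𝔏B, _hcnt, _h𝔏ne, hslab, hsupp, ⟨i₀, hpi₀⟩, hpbd, hsol⟩ :=
    S.exists_g3_slab_siegel R u uθ B σ.m hΛ E (eqSet_nonempty S.d (σ.N0 0) hT0)
      (siegel_count σ.m L₀ (σ.Dbox 0) (σ.Dθ 0) (σ.N0 0) (σ.T0 0) hcount) hbox.1 hbox.2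
      (fun e => σ.den₀ 0 e.1 e.2) hden₀1 hR hXb hAmax hA
  have hi₀ : i₀ ∈ 𝔏 := hsupp i₀ hpi₀
  -- the level-0 family
  refine ⟨⟨𝔏, R, u, uθ, p, i₀⟩, ?_, ?_⟩
  · -- admissibility
    have h𝔏card : 𝔏.card ≤ B.card := card_le_card h𝔏B
    refine ⟨h𝔏card.trans hcardB, ⟨i₀, hi₀, hpi₀⟩, S.feldman_deg_ne H 𝔏, S.feldman_R_ne H 𝔏,
      S.feldman_deg_le H hL 𝔏 h𝔏B, ?_, (S.feldman_box_le 𝔏 h𝔏B).1, (S.feldman_box_le 𝔏 h𝔏B).2,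
      fun i hi j => hXb i (h𝔏B hi) j, hslab i₀ hi₀, ?_, ?_, hSh 𝔏 p i₀ h𝔏B hi₀⟩
    · -- `p_le`
      intro i _
      refine (hpbd i).trans (le_trans ?_ hP)
      exact Int.ceil_le_ceil (mul_le_mul_of_nonneg_right (by exact_mod_cast h𝔏card)
        (le_trans zero_le_one hAmax))
    · -- `wt` at radius `4·2^m`
      have hρ1 : (1 : ℝ) ≤ 4 * (2 : ℝ) ^ σ.m := by
        have : (1 : ℝ) ≤ 2 ^ σ.m := one_le_pow₀ (by norm_num)
        nlinarith
      exact S.feldman_wt H 𝔏 h𝔏B hρ1 hBw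
    · -- `hasse`, pointwise
      intro i hi x τ
      obtain ⟨z₀, hz₀, hle⟩ := S.feldman_hasse H hH 𝔏 h𝔏B (σ.M₀ 0) hM₀ i hi x τ
      refine ⟨z₀, ?_, hle⟩
      rw [hden₀]; exact_mod_cast hz₀
  · -- vanishing at all `|x| ≤ N0 0`, `|τ| < T0 0`
    rw [G3Fam.vanish_all_iff]
    exact vanish_of_eqSet S R u uθ 𝔏 p hsol

end Summit.ABC.StewartYu.TwoSetup

end
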